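import Mathlib
import HarnessLib
import Summits.MatrixMultiplication.MatrixMultiplication.Theses.OutsiderSandwich
import Summits.MatrixMultiplication.MatrixMultiplication.Theorems.OutsiderSandwichTopSlope
import Summits.MatrixMultiplication.MatrixMultiplication.Theorems.OutsiderSandwichTopFibreTensor

/-!
# OutsiderSandwich — the top slope `μ*` is a MINIMUM; the residual, its inf-version and the uniform gap
(decomp-mm lens 4, gen 34, part 3/3)

Route `route-MatrixMultiplication-OutsiderSandwich`; cut of record UNCHANGED
(`closes (h₁ : LaserTangency) (h₂ : LaserMergeOptimal) (h₃ : SummitIffLaserTangency)`); theorem-only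
support for the residual `LaserMergeOptimal` (stmt-27897).

g32 (`OutsiderSandwichTopSlope`) introduced the top slope
`μ*(t, a) = inf {(log₂F(t) − a)/(ω − 2) : F universal, τ_F = ω}` (inline `sInf`, branch `ω > 2`) and
proved `TopFloor μ ⟺ μ ≤ μ*`, `SlopeCap μ' ⟹ μ* ≤ μ'`, `μ* < μ' ⟹ SlopeCap μ'`, with the exact cap iff
`SlopeCap μ' ⟺ μ* ≤ μ'` only under the HYPOTHESIS that the inf is attained («compactness … which
`SpectralMap` does not provide»).  Part 2 (`OutsiderSandwichTopFibreTensor.exists_top_min`) provides it.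

§1 (generic `t, a`; `ω > 2`; `F(t) > 0` at universal points): `exists_top_isLeast`, `sInf_mem_slopeSet`
   (μ* is a MIN), `exists_top_attaining_sInf`, `slopeCap_iff_sInf_le` (the exact cap iff, attainment
   hypothesis discharged), `topFloor_sInf`, `topFloor_and_slopeCap_iff` (`TopFloor μ ∧ SlopeCap μ ⟺ μ = μ*`:
   the unique touching slope).
§2 (`t = cw₂`, `a = log₂3`): `sInf_cw_mem`, `cwCap_iff_sInf_le` · **`laserMergeOptimal_iff_sInf_cw_eq_third`**
   (`LaserMergeOptimal ⟺ μ*(cw₂) = 1/3`, `ω > 2`; g32 had only `⟹` and «`⟸` up to attainment») ·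
   **`laserMergeOptimal_iff_forall_slopeCap`** (UNCONDITIONAL: the residual equals its inf-version
   `∀ ε > 0, SlopeCap cw₂ (log₂3) (1/3 + ε)`) · `two_lt_omega_of_not_laserMergeOptimal`, `exists_topFloor_of_not_laserMergeOptimal`,
   **`not_laserMergeOptimal_iff_exists_topFloor`**
   (`ω > 2`: `¬LaserMergeOptimal ⟺ ∃ μ > 1/3, TopFloor cw₂ (log₂3) μ` — failure of the residual is
   itself a top floor STRICTLY above the laser slope, i.e. exactly the kind of statement whose `μ = 1/2`
   instance is the attacked side) · `laserMergeOptimal_xor_topFloor` ·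
   **`exists_minimal_criminal`** (`¬LaserMergeOptimal ⟹` a top universal point minimising `F(cw₂)`
   over the top fibre, lying strictly above the corner `log₂3 + (ω−2)/3`) ·
   **`not_laserMergeOptimal_iff_uniform_gap`** (`¬LaserMergeOptimal ⟺ ∃ δ > 0, ∀ top F,
   log₂3 + (ω−2)/3 + δ ≤ x_F`: by compactness pointwise strictness upgrades to a UNIFORM gap) ·
   `laserMergeOptimal_iff_no_uniform_gap` (the residual: top points come arbitrarily close to the corner).

Honest tags: nothing here is claimed NEC beyond what the tree has (`LaserMergeOptimal` is NEC, g5); the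
file removes the attainment caveat from every g32 statement and gives the residual three exact
equivalent forms (min-slope `= 1/3`, inf-version, no uniform gap).
References: [cite: Strassen1988, Thm. 2.3–2.4, Thm. 3.8]; [cite: Zuiddam2018, Thm. 2.15];
[cite: CoppersmithWinograd1990, §6].
-/

set_option linter.dupNamespace false

noncomputable section

namespace Summit.MatrixMultiplication.MatrixMultiplication.Theorems.OutsiderSandwichTopSlopeAttained

open Literature.Computability.AlgebraicComplexity
open Summit.MatrixMultiplication.MatrixMultiplication.Theses.OutsiderSandwich
open Summit.MatrixMultiplication.MatrixMultiplication.Theorems.OutsiderSandwichLaserFloorCut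
  (three_le_map_cwTensor)
open Summit.MatrixMultiplication.MatrixMultiplication.Theorems.OutsiderSandwichLaserTangency
  (laserMergeOptimal_of_summit)
open Summit.MatrixMultiplication.MatrixMultiplication.Theorems.OutsiderSandwichSlopeDialCore
  (SlopeFloor SlopeCap two_le_omega)
open Summit.MatrixMultiplication.MatrixMultiplication.Theorems.OutsiderSandwichSlopeDial
  (cwCap_third_iff cwCap_of_laserMergeOptimal cwFloor_zero cwFloor_third)
open Summit.MatrixMultiplication.MatrixMultiplication.Theorems.OutsiderSandwichTopSlope
open Summit.MatrixMultiplication.MatrixMultiplication.Theorems.OutsiderSandwichTopFibreTensor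
  (exists_top_min)

/-! ## §1  `μ*` is a minimum (generic tensor `t`, intercept `a`, branch `ω > 2`) -/

section Generic

variable {ι κ μ : Type} [Fintype ι] [Fintype κ] [Fintype μ] {t : ι → κ → μ → ℂ} {a : ℝ}

/-- **A top point attains the least slope**: some top universal point `F` minimises `F(t)` over the
top fibre, and its slope `(log₂F(t) − a)/(ω − 2)` is the least element of the slope set (`ω > 2`,
`F(t) > 0` at universal points). [cite: Zuiddam2018, Thm. 2.15; Strassen1988, Thm. 2.3] -/
theorem exists_top_isLeast (hω : 2 < omega ℂ)
    (ht : ∀ F : SpectralMap ℂ, IsUniversalSpectralPoint ℂ F → 0 < F t) :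
    ∃ F : SpectralMap ℂ, IsUniversalSpectralPoint ℂ F ∧
      Real.logb 2 (F (matMulTensor ℂ 2 2 2)) = omega ℂ ∧
      (∀ G : SpectralMap ℂ, IsUniversalSpectralPoint ℂ G →
        Real.logb 2 (G (matMulTensor ℂ 2 2 2)) = omega ℂ → F t ≤ G t) ∧
      IsLeast {x : ℝ | ∃ F : SpectralMap ℂ, IsUniversalSpectralPoint ℂ F ∧
        Real.logb 2 (F (matMulTensor ℂ 2 2 2)) = omega ℂ ∧
        (Real.logb 2 (F t) - a) / (omega ℂ - 2) = x}
        ((Real.logb 2 (F t) - a) / (omega ℂ - 2)) := by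
  obtain ⟨F, hF, hFω, hmin⟩ := exists_top_min t
  refine ⟨F, hF, hFω, hmin, ⟨F, hF, hFω, rfl⟩, ?_⟩
  rintro x ⟨G, hG, hGω, rfl⟩
  have h1 : Real.logb 2 (F t) ≤ Real.logb 2 (G t) :=
    Real.logb_le_logb_of_le one_lt_two (ht F hF) (hmin G hG hGω)
  exact div_le_div_of_nonneg_right (by linarith) (sub_pos.2 hω).le

/-- **`μ* ∈` slope set** — the inf of g32's top slope is a MIN (`ω > 2`, `F(t) > 0`).
[cite: Zuiddam2018, Thm. 2.15; Strassen1988, Thm. 2.3] -/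
theorem sInf_mem_slopeSet (hω : 2 < omega ℂ)
    (ht : ∀ F : SpectralMap ℂ, IsUniversalSpectralPoint ℂ F → 0 < F t) :
    sInf {x : ℝ | ∃ F : SpectralMap ℂ, IsUniversalSpectralPoint ℂ F ∧
      Real.logb 2 (F (matMulTensor ℂ 2 2 2)) = omega ℂ ∧
      (Real.logb 2 (F t) - a) / (omega ℂ - 2) = x} ∈
    {x : ℝ | ∃ F : SpectralMap ℂ, IsUniversalSpectralPoint ℂ F ∧
      Real.logb 2 (F (matMulTensor ℂ 2 2 2)) = omega ℂ ∧
      (Real.logb 2 (F t) - a) / (omega ℂ - 2) = x} := by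
  obtain ⟨F, hF, hFω, -, hleast⟩ := exists_top_isLeast (a := a) hω ht
  rw [hleast.csInf_eq]
  exact hleast.1

/-- **The minimal top point realises `μ*`**: `∃ F` top with `(log₂F(t) − a)/(ω−2) = μ*` and `F(t) ≤ G(t)`
for all top `G`. [cite: Zuiddam2018, Thm. 2.15] -/
theorem exists_top_attaining_sInf (hω : 2 < omega ℂ)
    (ht : ∀ F : SpectralMap ℂ, IsUniversalSpectralPoint ℂ F → 0 < F t) :
    ∃ F : SpectralMap ℂ, IsUniversalSpectralPoint ℂ F ∧
      Real.logb 2 (F (matMulTensor ℂ 2 2 2)) = omega ℂ ∧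
      (∀ G : SpectralMap ℂ, IsUniversalSpectralPoint ℂ G →
        Real.logb 2 (G (matMulTensor ℂ 2 2 2)) = omega ℂ → F t ≤ G t) ∧
      (Real.logb 2 (F t) - a) / (omega ℂ - 2) =
        sInf {x : ℝ | ∃ F : SpectralMap ℂ, IsUniversalSpectralPoint ℂ F ∧
          Real.logb 2 (F (matMulTensor ℂ 2 2 2)) = omega ℂ ∧
          (Real.logb 2 (F t) - a) / (omega ℂ - 2) = x} := by
  obtain ⟨F, hF, hFω, hmin, hleast⟩ := exists_top_isLeast (a := a) hω ht
  exact ⟨F, hF, hFω, hmin, hleast.csInf_eq.symm⟩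

/-- **The exact cap iff, hypothesis-free**: `SlopeCap t a μ' ⟺ μ* ≤ μ'` (`ω > 2`, slope-`0` floor,
`F(t) > 0`) — g32's `slopeCap_iff_of_mem` with its attainment hypothesis discharged.
[cite: Strassen1988, Thm. 2.3–2.4; Zuiddam2018, Thm. 2.15] -/
theorem slopeCap_iff_sInf_le (hω : 2 < omega ℂ) (h0 : SlopeFloor t a 0)
    (ht : ∀ F : SpectralMap ℂ, IsUniversalSpectralPoint ℂ F → 0 < F t) {s' : ℝ} :
    SlopeCap t a s' ↔
    sInf {x : ℝ | ∃ F : SpectralMap ℂ, IsUniversalSpectralPoint ℂ F ∧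
      Real.logb 2 (F (matMulTensor ℂ 2 2 2)) = omega ℂ ∧
      (Real.logb 2 (F t) - a) / (omega ℂ - 2) = x} ≤ s' :=
  slopeCap_iff_of_mem hω h0 (sInf_mem_slopeSet hω ht)

/-- `TopFloor t a μ*` holds (the floor at the least slope). [cite: Strassen1988, Thm. 2.3–2.4] -/
theorem topFloor_sInf (hω : 2 < omega ℂ) (h0 : SlopeFloor t a 0) :
    ∀ F : SpectralMap ℂ, IsUniversalSpectralPoint ℂ F →
      Real.logb 2 (F (matMulTensor ℂ 2 2 2)) = omega ℂ →
      a + sInf {x : ℝ | ∃ F : SpectralMap ℂ, IsUniversalSpectralPoint ℂ F ∧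
        Real.logb 2 (F (matMulTensor ℂ 2 2 2)) = omega ℂ ∧
        (Real.logb 2 (F t) - a) / (omega ℂ - 2) = x} * (omega ℂ - 2) ≤ Real.logb 2 (F t) :=
  (topFloor_iff_le_sInf hω h0).2 le_rfl

/-- **The unique touching slope**: `TopFloor t a μ ∧ SlopeCap t a μ ⟺ μ = μ*` (`ω > 2`).
[cite: Strassen1988, Thm. 2.3–2.4; Zuiddam2018, Thm. 2.15] -/
theorem topFloor_and_slopeCap_iff (hω : 2 < omega ℂ) (h0 : SlopeFloor t a 0)
    (ht : ∀ F : SpectralMap ℂ, IsUniversalSpectralPoint ℂ F → 0 < F t) {s : ℝ} :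
    ((∀ F : SpectralMap ℂ, IsUniversalSpectralPoint ℂ F →
      Real.logb 2 (F (matMulTensor ℂ 2 2 2)) = omega ℂ → a + s * (omega ℂ - 2) ≤ Real.logb 2 (F t)) ∧
      SlopeCap t a s) ↔
    s = sInf {x : ℝ | ∃ F : SpectralMap ℂ, IsUniversalSpectralPoint ℂ F ∧
      Real.logb 2 (F (matMulTensor ℂ 2 2 2)) = omega ℂ ∧
      (Real.logb 2 (F t) - a) / (omega ℂ - 2) = x} := by
  rw [topFloor_iff_le_sInf hω h0, slopeCap_iff_sInf_le hω h0 ht]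
  constructor
  · rintro ⟨h1, h2⟩; exact le_antisymm h1 h2
  · intro h; exact ⟨h.le, h.ge⟩

end Generic

/-! ## §2  `t = cw₂`, `a = log₂3`: the residual, exactly -/

section Cw

/-- `F(cw₂) > 0` at universal points (`F(cw₂) ≥ 3`). -/
theorem map_cwTensor_pos : ∀ F : SpectralMap ℂ, IsUniversalSpectralPoint ℂ F → 0 < F (cwTensor ℂ 2) :=
  fun _ hF => lt_of_lt_of_le (by norm_num) (three_le_map_cwTensor hF)

/-- **`μ*(cw₂)` is attained** (`ω > 2`). [cite: Zuiddam2018, Thm. 2.15; CoppersmithWinograd1990, §6] -/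
theorem sInf_cw_mem (hω : 2 < omega ℂ) :
    sInf {x : ℝ | ∃ F : SpectralMap ℂ, IsUniversalSpectralPoint ℂ F ∧
      Real.logb 2 (F (matMulTensor ℂ 2 2 2)) = omega ℂ ∧
      (Real.logb 2 (F (cwTensor ℂ 2)) - Real.logb 2 3) / (omega ℂ - 2) = x} ∈
    {x : ℝ | ∃ F : SpectralMap ℂ, IsUniversalSpectralPoint ℂ F ∧
      Real.logb 2 (F (matMulTensor ℂ 2 2 2)) = omega ℂ ∧
      (Real.logb 2 (F (cwTensor ℂ 2)) - Real.logb 2 3) / (omega ℂ - 2) = x} :=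
  sInf_mem_slopeSet hω map_cwTensor_pos

/-- **`SlopeCap cw₂ (log₂3) μ' ⟺ μ*(cw₂) ≤ μ'`** exactly (`ω > 2`). [cite: CoppersmithWinograd1990, §6] -/
theorem cwCap_iff_sInf_le (hω : 2 < omega ℂ) {s' : ℝ} :
    SlopeCap (cwTensor ℂ 2) (Real.logb 2 3) s' ↔
    sInf {x : ℝ | ∃ F : SpectralMap ℂ, IsUniversalSpectralPoint ℂ F ∧
      Real.logb 2 (F (matMulTensor ℂ 2 2 2)) = omega ℂ ∧
      (Real.logb 2 (F (cwTensor ℂ 2)) - Real.logb 2 3) / (omega ℂ - 2) = x} ≤ s' :=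
  slopeCap_iff_sInf_le hω cwFloor_zero map_cwTensor_pos

/-- **`LaserMergeOptimal ⟺ μ*(cw₂) = 1/3`** (`ω > 2`) — g32 had `⟹`; `⟸` is attainment.
[cite: CoppersmithWinograd1990, §6; Zuiddam2018, Thm. 2.15] -/
theorem laserMergeOptimal_iff_sInf_cw_eq_third (hω : 2 < omega ℂ) :
    LaserMergeOptimal ↔
    sInf {x : ℝ | ∃ F : SpectralMap ℂ, IsUniversalSpectralPoint ℂ F ∧
      Real.logb 2 (F (matMulTensor ℂ 2 2 2)) = omega ℂ ∧
      (Real.logb 2 (F (cwTensor ℂ 2)) - Real.logb 2 3) / (omega ℂ - 2) = x} = 1 / 3 := by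
  refine ⟨sInf_cw_eq_third_of_laserMergeOptimal hω, fun h => ?_⟩
  rw [laserMergeOptimal_iff_third_mem hω, ← h]
  exact sInf_cw_mem hω

/-- **The residual equals its inf-version, unconditionally**:
`LaserMergeOptimal ⟺ ∀ ε > 0, SlopeCap cw₂ (log₂3) (1/3 + ε)`. [cite: CoppersmithWinograd1990, §6] -/
theorem laserMergeOptimal_iff_forall_slopeCap :
    LaserMergeOptimal ↔ ∀ ε : ℝ, 0 < ε → SlopeCap (cwTensor ℂ 2) (Real.logb 2 3) (1 / 3 + ε) := by
  refine ⟨fun h ε hε => cwCap_of_laserMergeOptimal (by linarith) h, fun h => ?_⟩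
  rcases two_le_omega.eq_or_lt with h2 | h2
  · exact laserMergeOptimal_of_summit ((_root_.MatrixMultiplication_iff).2 h2.symm)
  · exact (laserMergeOptimal_iff_sInf_cw_eq_third h2).2 ((sInf_cw_eq_third_iff h2).2 h)

/-- `¬ LaserMergeOptimal ⟹ ω > 2` (the residual is necessary for `ω = 2`, g5). -/
theorem two_lt_omega_of_not_laserMergeOptimal (h : ¬ LaserMergeOptimal) : 2 < omega ℂ := by
  rcases two_le_omega.eq_or_lt with h2 | h2
  · exact absurd (laserMergeOptimal_of_summit ((_root_.MatrixMultiplication_iff).2 h2.symm)) h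
  · exact h2

/-- **Failure of the residual produces a top floor strictly above the laser slope**:
`¬ LaserMergeOptimal ⟹ ∃ μ > 1/3, TopFloor cw₂ (log₂3) μ` (namely `μ = μ*(cw₂)`).
[cite: CoppersmithWinograd1990, §6; Strassen1988, Thm. 2.3–2.4; Zuiddam2018, Thm. 2.15] -/
theorem exists_topFloor_of_not_laserMergeOptimal (h : ¬ LaserMergeOptimal) :
    ∃ s : ℝ, 1 / 3 < s ∧
      ∀ F : SpectralMap ℂ, IsUniversalSpectralPoint ℂ F →
        Real.logb 2 (F (matMulTensor ℂ 2 2 2)) = omega ℂ →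
          Real.logb 2 3 + s * (omega ℂ - 2) ≤ Real.logb 2 (F (cwTensor ℂ 2)) := by
  have hω := two_lt_omega_of_not_laserMergeOptimal h
  refine ⟨_, ?_, (topFloor_iff_le_sInf hω cwFloor_zero).2 le_rfl⟩
  exact lt_of_le_of_ne (third_le_sInf_cw hω)
    (fun h3 => h ((laserMergeOptimal_iff_sInf_cw_eq_third hω).2 h3.symm))

/-- **Exact complementarity in the branch `ω > 2`**:
`¬ LaserMergeOptimal ⟺ ∃ μ > 1/3, TopFloor cw₂ (log₂3) μ` — failure of the residual is itself a top
floor STRICTLY above the laser slope (the kind of statement whose `μ = 1/2` instance is the attacked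
side).  (At `ω = 2` both sides degenerate: the left is false, the right true.)
[cite: CoppersmithWinograd1990, §6; Strassen1988, Thm. 2.3–2.4; Zuiddam2018, Thm. 2.15] -/
theorem not_laserMergeOptimal_iff_exists_topFloor (hω : 2 < omega ℂ) :
    ¬ LaserMergeOptimal ↔ ∃ s : ℝ, 1 / 3 < s ∧
      ∀ F : SpectralMap ℂ, IsUniversalSpectralPoint ℂ F →
        Real.logb 2 (F (matMulTensor ℂ 2 2 2)) = omega ℂ →
          Real.logb 2 3 + s * (omega ℂ - 2) ≤ Real.logb 2 (F (cwTensor ℂ 2)) := by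
  refine ⟨exists_topFloor_of_not_laserMergeOptimal, ?_⟩
  rintro ⟨s, hs, htop⟩ h
  have hS := summit_of_topFloor_cw_of_laserMergeOptimal hs htop h
  exact absurd ((_root_.MatrixMultiplication_iff).1 hS) hω.ne'

/-- **Trichotomy collapsed** (`ω > 2`): exactly one of `LaserMergeOptimal`, `∃ μ > 1/3, TopFloor cw₂ (log₂3) μ`.
[cite: CoppersmithWinograd1990, §6; Strassen1988, Thm. 2.3–2.4] -/
theorem laserMergeOptimal_xor_topFloor (hω : 2 < omega ℂ) :
    Xor LaserMergeOptimal (∃ s : ℝ, 1 / 3 < s ∧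
      ∀ F : SpectralMap ℂ, IsUniversalSpectralPoint ℂ F →
        Real.logb 2 (F (matMulTensor ℂ 2 2 2)) = omega ℂ →
          Real.logb 2 3 + s * (omega ℂ - 2) ≤ Real.logb 2 (F (cwTensor ℂ 2))) := by
  rw [← not_laserMergeOptimal_iff_exists_topFloor hω]
  by_cases h : LaserMergeOptimal
  · exact Or.inl ⟨h, fun hn => hn h⟩
  · exact Or.inr ⟨h, h⟩

/-- **THE MINIMAL CRIMINAL.**  If the residual fails, there is a top universal point `F⋆` MINIMISING
`F(cw₂)` over the whole top fibre, it lies STRICTLY above the Coppersmith–Winograd corner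
(`log₂3 + (ω − 2)/3 < x_{F⋆}`), and its slope is `μ*(cw₂)`.  Any contradiction derived from the
extremality of `F⋆` proves the residual. [cite: Zuiddam2018, Thm. 2.15; CoppersmithWinograd1990, §6] -/
theorem exists_minimal_criminal (h : ¬ LaserMergeOptimal) :
    ∃ F : SpectralMap ℂ, IsUniversalSpectralPoint ℂ F ∧
      Real.logb 2 (F (matMulTensor ℂ 2 2 2)) = omega ℂ ∧
      (∀ G : SpectralMap ℂ, IsUniversalSpectralPoint ℂ G →
        Real.logb 2 (G (matMulTensor ℂ 2 2 2)) = omega ℂ → F (cwTensor ℂ 2) ≤ G (cwTensor ℂ 2)) ∧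
      Real.logb 2 3 + (omega ℂ - 2) / 3 < Real.logb 2 (F (cwTensor ℂ 2)) ∧
      (Real.logb 2 (F (cwTensor ℂ 2)) - Real.logb 2 3) / (omega ℂ - 2) =
        sInf {x : ℝ | ∃ F : SpectralMap ℂ, IsUniversalSpectralPoint ℂ F ∧
          Real.logb 2 (F (matMulTensor ℂ 2 2 2)) = omega ℂ ∧
          (Real.logb 2 (F (cwTensor ℂ 2)) - Real.logb 2 3) / (omega ℂ - 2) = x} := by
  have hω := two_lt_omega_of_not_laserMergeOptimal h
  obtain ⟨F, hF, hFω, hmin, hslope⟩ :=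
    exists_top_attaining_sInf (a := Real.logb 2 3) hω map_cwTensor_pos
  refine ⟨F, hF, hFω, hmin, ?_, hslope⟩
  by_contra hle
  push Not at hle
  exact h (cwCap_third_iff.1 ⟨F, hF, hFω, by linarith⟩)

/-- **`¬ LaserMergeOptimal ⟺ a UNIFORM gap above the corner`** (compactness upgrades pointwise
strictness): `∃ δ > 0, ∀ F universal, τ_F = ω → log₂3 + (ω − 2)/3 + δ ≤ x_F`.
[cite: Zuiddam2018, Thm. 2.15; CoppersmithWinograd1990, §6] -/
theorem not_laserMergeOptimal_iff_uniform_gap :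
    ¬ LaserMergeOptimal ↔ ∃ δ : ℝ, 0 < δ ∧
      ∀ F : SpectralMap ℂ, IsUniversalSpectralPoint ℂ F →
        Real.logb 2 (F (matMulTensor ℂ 2 2 2)) = omega ℂ →
          Real.logb 2 3 + (omega ℂ - 2) / 3 + δ ≤ Real.logb 2 (F (cwTensor ℂ 2)) := by
  constructor
  · intro h
    obtain ⟨F, hF, hFω, hmin, hlt, -⟩ := exists_minimal_criminal h
    refine ⟨Real.logb 2 (F (cwTensor ℂ 2)) - (Real.logb 2 3 + (omega ℂ - 2) / 3), sub_pos.2 hlt,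
      fun G hG hGω => ?_⟩
    have h1 : Real.logb 2 (F (cwTensor ℂ 2)) ≤ Real.logb 2 (G (cwTensor ℂ 2)) :=
      Real.logb_le_logb_of_le one_lt_two (map_cwTensor_pos F hF) (hmin G hG hGω)
    linarith
  · rintro ⟨δ, hδ, hgap⟩ h
    obtain ⟨G, hG, hGω, hGcap⟩ := cwCap_third_iff.2 h
    have h1 := hgap G hG hGω
    linarith

/-- **The residual as «no uniform gap»**: `LaserMergeOptimal ⟺ ∀ δ > 0, ∃ F universal, τ_F = ω ∧
x_F < log₂3 + (ω − 2)/3 + δ`. [cite: Zuiddam2018, Thm. 2.15; CoppersmithWinograd1990, §6] -/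
theorem laserMergeOptimal_iff_no_uniform_gap :
    LaserMergeOptimal ↔ ∀ δ : ℝ, 0 < δ →
      ∃ F : SpectralMap ℂ, IsUniversalSpectralPoint ℂ F ∧
        Real.logb 2 (F (matMulTensor ℂ 2 2 2)) = omega ℂ ∧
          Real.logb 2 (F (cwTensor ℂ 2)) < Real.logb 2 3 + (omega ℂ - 2) / 3 + δ := by
  have h := not_laserMergeOptimal_iff_uniform_gap
  rw [not_iff_comm, Iff.comm] at h
  rw [h]
  push Not
  exact Iff.rfl

end Cw

end Summit.MatrixMultiplication.MatrixMultiplication.Theorems.OutsiderSandwichTopSlopeAttained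

end
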